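import Summits.Ventures.Crystal3D.Theorems.StickyWulffConstantNoReconstructionGainZonedFilmLocal
import HarnessLib

/-!
# The atom at every normal for ZONED films: an antipodal base and steep-or-flat strata

HONEST FRAMING. Part of the venture `Summits/Ventures/Crystal3D` (cell `crystal3d-full`), helper
`--supports` the crux `NoReconstructionGain` (stmt-Ventures-19144, route
`route-Ventures-StickyWulffConstant`), line `adhesion`.  A COMPOSITION rung for the R26
certificate line, valid at EVERY normal `ν`.  The film `X \ P` around the `ν`-slab sample `P` is
cut into ZONES by a label `Z : film → ℕ` (and a rim set `E` of `≤ ρ` balls where nothing is asked):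

* zone `0` (the base): every ball has `≤ 6` contacts, or its contacts OTHER than higher-zone film
  balls lie on `≤ 6` lines through its centre (antipodally supported shells: registry balls, cosets,
  independently rotated sub-cuboctahedral shells) and it touches the substrate only from outside the
  slab region — the class of `antipodalFilm_adhesion`, now allowed to carry arbitrary strata on top;
* zone `i ≥ 1` (a stratum with its own unit axis `nᵢ`): every contact of a zone-`i` ball with the
  substrate or with a LOWER zone is steep from below along `nᵢ` (`⟪y − b, nᵢ⟫ ≤ −√(2/3)`), and every
  contact inside the zone is flat (`⟪y − b, nᵢ⟫ = 0`) or steep (`|⟪y − b, nᵢ⟫| ≥ √(2/3)`) — the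
  steep-or-flat class of `steepFlatAdhesion111`, per stratum, along ANY axis, at ANY normal; contacts
  with HIGHER zones are unrestricted.

`zoned_cross_le` (core, any substrate `P ⊆ X`, any midpoint-convex grading of the base), `zonedFilm_adhesion_of_convex` and `zonedFilm_adhesion` (**the rungs**, `R = 1`, `C = 6`; registered by name; the latter with the convex slab gauge): under these hypotheses
`#cross(P, X \ P) ≤ contactDeficiency (X \ P) + 6ρ`.  Examples: fcc continuation (zone 0) capped by a
Barlow-faulted or twinned grain layered along an INCLINED `{111}` axis `n ≠ ν` (zone 1) and a
differently layered grain on top of that (zone 2); strata above AND below the slab with opposite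
axes; at `ν = e₃` with `Z ≡ 1` the steep-or-flat films, at any `ν` with `Z ≡ 0` the antipodal films.

Ingredients (`…ZonedFilmLocal`): `card_negCone_le_three_axis` (≤ 3 contacts in the `35°` cone
about any axis), `card_thin_band_le_six_axis`; the per-ball lemmas `steepFlat_noGainPotential` and
`antipodal_noGainPotential_of_above`; here: the lexicographic potential
`Φ = Z·M + (rank inside the zone)` (convex slab gauge in zone 0, `nᵢ`-height in zone `i`) and the
telescoping `cross_le_of_potential`.

WHAT THIS IS NOT: strata touching the substrate or a lower zone other than steeply along their own
axis (the foot of an inclined fault AT the interface), non-centrosymmetric 12-shells in the base;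
rung F-C1 not moved.
-/

noncomputable section

namespace Summit.Ventures.Crystal3D.Theorems

open Summit.Ventures.Crystal3D Finset
open Literature.MathematicalPhysics.StatisticalMechanics (fccStacking orderedContacts contactDeficiency)
open scoped InnerProductSpace

/-! ### The rung -/

/-- **The zoned certificate (core, substrate-shape free).**  `X` a finite unit packing, `P ⊆ X`
any substrate, `E ⊆ X \ P` a rim set, `g` a midpoint-convex real function, `Z` a zone label with
unit axes `n i`.  If at every film ball `q ∉ E`
* (`Z q = 0`) `q` has `≤ 6` contacts, or its contacts other than higher-zone film balls lie on `≤ 6`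
  lines through `q` and its substrate partners have `g < g q`;
* (`Z q ≠ 0`) substrate and lower-zone partners are steep from below along `n (Z q)` and same-zone
  partners are flat or steep along `n (Z q)`;
then `#cross(P, X \ P) ≤ contactDeficiency (X \ P) + 6·#E`. -/
theorem zoned_cross_le (X P : Finset (EuclideanSpace ℝ (Fin 3)))
    (hX : ∀ p ∈ X, ∀ q ∈ X, p ≠ q → 1 ≤ dist p q) (hPX : P ⊆ X)
    (Z : EuclideanSpace ℝ (Fin 3) → ℕ) (n : ℕ → EuclideanSpace ℝ (Fin 3)) (hn : ∀ i, ‖n i‖ = 1)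
    (E : Finset (EuclideanSpace ℝ (Fin 3))) (hE : E ⊆ X \ P)
    (g : EuclideanSpace ℝ (Fin 3) → ℝ) (hg : ∀ y w : EuclideanSpace ℝ (Fin 3), 2 * g y ≤ g (y + w) + g (y - w))
    (hz0 : ∀ q ∈ (X \ P) \ E, Z q = 0 →
      (X.filter fun x => dist q x = 1).card ≤ 6 ∨
      ((∃ W : Finset (EuclideanSpace ℝ (Fin 3)), W.card ≤ 6 ∧
          ∀ x ∈ X, dist q x = 1 → (x ∈ X \ P ∧ 0 < Z x) ∨ ∃ w ∈ W, x = q + w ∨ x = q - w) ∧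
        ∀ p ∈ P, dist q p = 1 → g p < g q))
    (hz1 : ∀ q ∈ (X \ P) \ E, Z q ≠ 0 → ∀ y ∈ X, dist q y = 1 →
      (y ∈ P → ⟪y - q, n (Z q)⟫_ℝ ≤ -Real.sqrt (2 / 3)) ∧
      (y ∈ X \ P → Z y < Z q → ⟪y - q, n (Z q)⟫_ℝ ≤ -Real.sqrt (2 / 3)) ∧
      (y ∈ X \ P → Z y = Z q → ⟪y - q, n (Z q)⟫_ℝ = 0 ∨
        Real.sqrt (2 / 3) ≤ ⟪y - q, n (Z q)⟫_ℝ ∨ ⟪y - q, n (Z q)⟫_ℝ ≤ -Real.sqrt (2 / 3))) :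
    ((((P ×ˢ (X \ P)).filter fun pq => dist pq.1 pq.2 = 1).card : ℕ) : ℝ) ≤
      contactDeficiency (X \ P) + 6 * (E.card : ℝ) := by
  classical
  -- the grading of zone 0 is `g`; the axis heights grade zones ≥ 1
  set Q := X \ P with hQ
  set A0 := Q.filter fun a => Z a = 0 with hA0
  set M : ℤ := (Q.card : ℤ) + 1 with hM
  set r : EuclideanSpace ℝ (Fin 3) → ℤ := fun y =>
    if Z y = 0 then ((A0.filter fun a => g a < g y).card : ℤ)
    else (((Q.filter fun b => Z b = Z y).filter fun b => ⟪b, n (Z y)⟫_ℝ < ⟪y, n (Z y)⟫_ℝ).card : ℤ)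
    with hr
  set Φ : EuclideanSpace ℝ (Fin 3) → ℤ := fun y => (Z y : ℤ) * M + r y with hΦ
  -- ranks are in `[0, M)`
  have hr0 : ∀ y, 0 ≤ r y := fun y => by
    simp only [hr]; split_ifs <;> exact Nat.cast_nonneg _
  have hrM : ∀ y, r y < M := fun y => by
    simp only [hr, hM]
    split_ifs
    · have hle : (((A0.filter fun a => g a < g y).card : ℕ) : ℤ) ≤ (Q.card : ℤ) := by
        exact_mod_cast (card_le_card (filter_subset _ _)).trans (card_le_card (filter_subset _ _))
      linarith
    · have hle : ((((Q.filter fun b => Z b = Z y).filter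
          fun b => ⟪b, n (Z y)⟫_ℝ < ⟪y, n (Z y)⟫_ℝ).card : ℕ) : ℤ) ≤ (Q.card : ℤ) := by
        exact_mod_cast (card_le_card (filter_subset _ _)).trans (card_le_card (filter_subset _ _))
      linarith
  have hΦlt : ∀ x y, Φ x < Φ y ↔ Z x < Z y ∨ (Z x = Z y ∧ r x < r y) := fun x y => by
    simp only [hΦ]
    rw [zoneLex_lt_iff _ _ _ _ _ (hr0 x) (hrM x) (hr0 y) (hrM y)]
    constructor
    · rintro (h | ⟨h, h'⟩)
      · exact Or.inl (by exact_mod_cast h)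
      · exact Or.inr ⟨by exact_mod_cast h, h'⟩
    · rintro (h | ⟨h, h'⟩)
      · exact Or.inl (by exact_mod_cast h)
      · exact Or.inr ⟨by exact_mod_cast h, h'⟩
  have hΦeq : ∀ x y, Φ x = Φ y ↔ Z x = Z y ∧ r x = r y := fun x y => by
    simp only [hΦ]
    rw [zoneLex_eq_iff _ _ _ _ _ (hr0 x) (hrM x) (hr0 y) (hrM y)]
    constructor
    · rintro ⟨h, h'⟩; exact ⟨by exact_mod_cast h, h'⟩
    · rintro ⟨h, h'⟩; exact ⟨by exact_mod_cast h, h'⟩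
  set h : ℝ := Real.sqrt (2 / 3) with hhdef
  have hhpos : 0 < h := Real.sqrt_pos.2 (by norm_num)
  -- the telescoping reduction
  have hmain := cross_le_of_potential X P E hX hPX hE Φ fun q hq => by
    have hqQ : q ∈ Q := (mem_sdiff.1 hq).1
    by_cases hZq : Z q = 0
    · rcases hz0 q hq hZq with hdeg | ⟨⟨W, hW, hslot⟩, hout⟩
      · -- at most six contacts: (T2) for any potential
        rw [noGainPotential_iff X P hPX Φ q]
        have h1 := card_partners_eq_plug_add_film X P hPX q
        have h2 := card_film_partners_eq (X \ P) Φ q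
        zify at h1 h2 hdeg
        have h3 : (0 : ℤ) ≤ (((X \ P).filter fun x => dist q x = 1 ∧ Φ q < Φ x).card : ℤ) :=
          Nat.cast_nonneg _
        linarith
      · -- antipodal ball of the base: gauge order on `A0`, higher zones exempt
        have hqA0 : q ∈ A0 := mem_filter.2 ⟨hqQ, hZq⟩
        have hA0Q : A0 ⊆ X \ P := filter_subset _ _
        have hrq : ∀ y ∈ A0, r y = ((A0.filter fun a => g a < g y).card : ℤ) := fun y hy => by
          simp only [hr, (mem_filter.1 hy).2, if_true]
        refine antipodal_noGainPotential_of_above X P A0 hPX hA0Q q Φ g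
          (fun x hx _ => ?_) (fun x hx _ => ?_) (fun x hx _ => ?_) (fun p hp hd => ?_)
          (fun w => ?_) W hW (fun x hx hd hxn => ?_)
        · -- film partners outside `A0` are in a higher zone
          have hxQ : x ∈ Q := (mem_sdiff.1 hx).1
          have hZx : Z x ≠ 0 := fun h0 => (mem_sdiff.1 hx).2 (mem_filter.2 ⟨hxQ, h0⟩)
          rw [hΦlt]; exact Or.inl (by rw [hZq]; exact Nat.pos_of_ne_zero hZx)
        · rw [hΦlt, hrq x hx, hrq q hqA0, (mem_filter.1 hx).2, hZq]
          rw [rank_lt_iff A0 g x q hx]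
          simp
        · rw [hΦeq, hrq x hx, hrq q hqA0, (mem_filter.1 hx).2, hZq]
          rw [rank_eq_iff A0 g x q hx hqA0]
          simp
        · exact hout p hp hd
        · exact hg q w
        · rcases hslot x hx hd with ⟨hxQ, hZx⟩ | hw
          · exfalso
            refine hxn (mem_sdiff.2 ⟨hxQ, fun hxA0 => ?_⟩)
            have := (mem_filter.1 hxA0).2
            omega
          · exact hw
    · -- a stratum ball: steep-or-flat along its axis
      set i := Z q with hi
      set Bi := Q.filter fun b => Z b = i with hBi
      have hqBi : q ∈ Bi := mem_filter.2 ⟨hqQ, rfl⟩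
      have hrb : ∀ y ∈ Bi, r y = ((Bi.filter fun b => ⟪b, n i⟫_ℝ < ⟪y, n i⟫_ℝ).card : ℤ) := by
        intro y hy
        have hZy : Z y = i := (mem_filter.1 hy).2
        simp only [hr, hZy, hZq, if_false, hBi]
      refine steepFlat_noGainPotential X P hX hPX q Φ (n i) (hn i) (fun x hx hd hcase => ?_)
        (fun x hx hd hΦx => ?_)
      · obtain ⟨hyP, hylow, hysame⟩ := hz1 q hq hZq x hx hd
        rcases hcase with hxP | ⟨hxQ, hΦx⟩
        · exact hyP hxP
        · rw [hΦlt] at hΦx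
          rcases hΦx with hZlt | ⟨hZeq, hrlt⟩
          · exact hylow hxQ hZlt
          · -- same zone, lower rank: lower along the axis, hence steep from below
            have hxBi : x ∈ Bi := mem_filter.2 ⟨hxQ, hZeq⟩
            rw [hrb x hxBi, hrb q hqBi, rank_lt_iff Bi (fun y => ⟪y, n i⟫_ℝ) x q hxBi] at hrlt
            have hsub : ⟪x - q, n i⟫_ℝ = ⟪x, n i⟫_ℝ - ⟪q, n i⟫_ℝ := inner_sub_left _ _ _
            rcases hysame hxQ hZeq with h0 | hup | hdown
            · exfalso; linarith
            · exfalso; linarith [hhpos]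
            · exact hdown
      · obtain ⟨_, _, hysame⟩ := hz1 q hq hZq x (mem_sdiff.1 hx).1 hd
        rw [hΦeq] at hΦx
        obtain ⟨hZeq, hreq⟩ := hΦx
        have hxBi : x ∈ Bi := mem_filter.2 ⟨hx, hZeq⟩
        rw [hrb x hxBi, hrb q hqBi, rank_eq_iff Bi (fun y => ⟪y, n i⟫_ℝ) x q hxBi hqBi] at hreq
        have hsub : ⟪x - q, n i⟫_ℝ = ⟪x, n i⟫_ℝ - ⟪q, n i⟫_ℝ := inner_sub_left _ _ _
        have h0 : ⟪x - q, n i⟫_ℝ = 0 := by rw [hsub, hreq, sub_self]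
        rw [h0, abs_zero]; norm_num
  exact hmain

/-- **The atom at every normal for zoned films, convex-grading form** (`R = 1`, `C = 6`;
registered by name on stmt-Ventures-19144).  As `zonedFilm_adhesion`, but the base zone is certified
by ANY midpoint-convex real function `g` supplied with the zones (the slab gauge, a linear height,
the distance to a convex set, …): zone-0 balls need their substrate partners to satisfy `g p < g q`. -/
theorem zonedFilm_adhesion_of_convex :
    ∃ R C : ℝ, 1 ≤ R ∧ ∀ ν : EuclideanSpace ℝ (Fin 3), ‖ν‖ = 1 → ∀ ρ : ℝ, R ≤ ρ →
      ∀ X P : Finset (EuclideanSpace ℝ (Fin 3)),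
      (∀ p ∈ X, ∀ q ∈ X, p ≠ q → 1 ≤ dist p q) → P ⊆ X →
      (∀ p, p ∈ P ↔ (p ∈ fccStacking 1 (Real.sqrt (2 / 3)) ∧ -(2 * R) ≤ ⟪p, ν⟫_ℝ ∧
        ⟪p, ν⟫_ℝ ≤ -R ∧ ‖p‖ ^ 2 - ⟪p, ν⟫_ℝ ^ 2 ≤ ρ ^ 2)) →
      (∃ (Z : EuclideanSpace ℝ (Fin 3) → ℕ) (n : ℕ → EuclideanSpace ℝ (Fin 3))
          (E : Finset (EuclideanSpace ℝ (Fin 3))) (g : EuclideanSpace ℝ (Fin 3) → ℝ),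
        E ⊆ X \ P ∧ (E.card : ℝ) ≤ ρ ∧ (∀ i, ‖n i‖ = 1) ∧
        (∀ y w : EuclideanSpace ℝ (Fin 3), 2 * g y ≤ g (y + w) + g (y - w)) ∧
        (∀ q ∈ (X \ P) \ E, Z q = 0 →
          (X.filter fun x => dist q x = 1).card ≤ 6 ∨
          ((∃ W : Finset (EuclideanSpace ℝ (Fin 3)), W.card ≤ 6 ∧
              ∀ x ∈ X, dist q x = 1 → (x ∈ X \ P ∧ 0 < Z x) ∨
                ∃ w ∈ W, x = q + w ∨ x = q - w) ∧
            ∀ p ∈ P, dist q p = 1 → g p < g q)) ∧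
        (∀ q ∈ (X \ P) \ E, Z q ≠ 0 → ∀ y ∈ X, dist q y = 1 →
          (y ∈ P → ⟪y - q, n (Z q)⟫_ℝ ≤ -Real.sqrt (2 / 3)) ∧
          (y ∈ X \ P → Z y < Z q → ⟪y - q, n (Z q)⟫_ℝ ≤ -Real.sqrt (2 / 3)) ∧
          (y ∈ X \ P → Z y = Z q → ⟪y - q, n (Z q)⟫_ℝ = 0 ∨
            Real.sqrt (2 / 3) ≤ ⟪y - q, n (Z q)⟫_ℝ ∨ ⟪y - q, n (Z q)⟫_ℝ ≤ -Real.sqrt (2 / 3)))) →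
      ((((P ×ˢ (X \ P)).filter fun pq => dist pq.1 pq.2 = 1).card : ℕ) : ℝ) ≤
        contactDeficiency (X \ P) + C * ρ := by
  classical
  refine ⟨1, 6, le_rfl, fun ν _ ρ _ X P hX hPX _ hzone => ?_⟩
  obtain ⟨Z, n, E, g, hE, hEcard, hn, hg, hz0, hz1⟩ := hzone
  have hmain := zoned_cross_le X P hX hPX Z n hn E hE g hg hz0 hz1
  calc ((((P ×ˢ (X \ P)).filter fun pq => dist pq.1 pq.2 = 1).card : ℕ) : ℝ)
      ≤ contactDeficiency (X \ P) + 6 * (E.card : ℝ) := hmain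
    _ ≤ contactDeficiency (X \ P) + 6 * ρ := by linarith

/-- **The atom at every normal for zoned films** (`R = 1`, `C = 6`; registered by name on
stmt-Ventures-19144).  For every unit `ν`, `ρ ≥ 1`, every finite unit packing `X ⊇ P` around the
`ν`-slab sample `P` of `Λ₀`, suppose the film carries a zone label `Z`, unit axes `n i`, and a rim
set `E ⊆ X \ P` of at most `ρ` balls such that, at every film ball `q ∉ E`:
* if `Z q = 0`: `q` has `≤ 6` contacts, or (its contacts other than film balls of higher zone lie
  on `≤ 6` lines through `q`, and `q` touches the substrate only from outside the slab region);
* if `Z q ≠ 0`: every substrate partner and every lower-zone film partner `y` has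
  `⟪y − q, n (Z q)⟫ ≤ −√(2/3)`, and every same-zone partner has `⟪y − q, n (Z q)⟫ = 0` or
  `≥ √(2/3)` or `≤ −√(2/3)`.
Then `#cross(P, X \ P) ≤ contactDeficiency (X \ P) + 6ρ` (the convex-grading form with the slab
gauge of `…OffRegistry`). -/
theorem zonedFilm_adhesion :
    ∃ R C : ℝ, 1 ≤ R ∧ ∀ ν : EuclideanSpace ℝ (Fin 3), ‖ν‖ = 1 → ∀ ρ : ℝ, R ≤ ρ →
      ∀ X P : Finset (EuclideanSpace ℝ (Fin 3)),
      (∀ p ∈ X, ∀ q ∈ X, p ≠ q → 1 ≤ dist p q) → P ⊆ X →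
      (∀ p, p ∈ P ↔ (p ∈ fccStacking 1 (Real.sqrt (2 / 3)) ∧ -(2 * R) ≤ ⟪p, ν⟫_ℝ ∧
        ⟪p, ν⟫_ℝ ≤ -R ∧ ‖p‖ ^ 2 - ⟪p, ν⟫_ℝ ^ 2 ≤ ρ ^ 2)) →
      (∃ (Z : EuclideanSpace ℝ (Fin 3) → ℕ) (n : ℕ → EuclideanSpace ℝ (Fin 3))
          (E : Finset (EuclideanSpace ℝ (Fin 3))),
        E ⊆ X \ P ∧ (E.card : ℝ) ≤ ρ ∧ (∀ i, ‖n i‖ = 1) ∧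
        (∀ q ∈ (X \ P) \ E, Z q = 0 →
          (X.filter fun x => dist q x = 1).card ≤ 6 ∨
          ((∃ W : Finset (EuclideanSpace ℝ (Fin 3)), W.card ≤ 6 ∧
              ∀ x ∈ X, dist q x = 1 → (x ∈ X \ P ∧ 0 < Z x) ∨
                ∃ w ∈ W, x = q + w ∨ x = q - w) ∧
            ∀ p ∈ P, dist q p = 1 →
              ¬(-(2 * R) ≤ ⟪q, ν⟫_ℝ ∧ ⟪q, ν⟫_ℝ ≤ -R ∧ ‖q‖ ^ 2 - ⟪q, ν⟫_ℝ ^ 2 ≤ ρ ^ 2))) ∧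
        (∀ q ∈ (X \ P) \ E, Z q ≠ 0 → ∀ y ∈ X, dist q y = 1 →
          (y ∈ P → ⟪y - q, n (Z q)⟫_ℝ ≤ -Real.sqrt (2 / 3)) ∧
          (y ∈ X \ P → Z y < Z q → ⟪y - q, n (Z q)⟫_ℝ ≤ -Real.sqrt (2 / 3)) ∧
          (y ∈ X \ P → Z y = Z q → ⟪y - q, n (Z q)⟫_ℝ = 0 ∨
            Real.sqrt (2 / 3) ≤ ⟪y - q, n (Z q)⟫_ℝ ∨ ⟪y - q, n (Z q)⟫_ℝ ≤ -Real.sqrt (2 / 3)))) →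
      ((((P ×ˢ (X \ P)).filter fun pq => dist pq.1 pq.2 = 1).card : ℕ) : ℝ) ≤
        contactDeficiency (X \ P) + C * ρ := by
  classical
  refine ⟨1, 6, le_rfl, fun ν hν ρ hρ X P hX hPX hP hzone => ?_⟩
  obtain ⟨Z, n, E, hE, hEcard, hn, hz0, hz1⟩ := hzone
  -- the convex slab gauge separates the substrate from the film balls outside the slab region
  set g : EuclideanSpace ℝ (Fin 3) → ℝ := fun y =>
    max (ρ ^ 2 * (2 * ⟪y, ν⟫_ℝ + 3 * 1) ^ 2) (1 ^ 2 * (‖y‖ ^ 2 - ⟪y, ν⟫_ℝ ^ 2)) with hg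
  have hconv : ∀ y w : EuclideanSpace ℝ (Fin 3), 2 * g y ≤ g (y + w) + g (y - w) := fun y w => by
    simp only [hg]; exact slabGauge_midpoint ν hν 1 ρ y w
  have hz0' : ∀ q ∈ (X \ P) \ E, Z q = 0 →
      (X.filter fun x => dist q x = 1).card ≤ 6 ∨
      ((∃ W : Finset (EuclideanSpace ℝ (Fin 3)), W.card ≤ 6 ∧
          ∀ x ∈ X, dist q x = 1 → (x ∈ X \ P ∧ 0 < Z x) ∨ ∃ w ∈ W, x = q + w ∨ x = q - w) ∧
        ∀ p ∈ P, dist q p = 1 → g p < g q) := by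
    intro q hq hZq
    rcases hz0 q hq hZq with hdeg | ⟨hW, hout⟩
    · exact Or.inl hdeg
    · refine Or.inr ⟨hW, fun p hp hd => ?_⟩
      obtain ⟨_, hp1, hp2, hp3⟩ := (hP p).1 hp
      have hle : g p ≤ 1 ^ 2 * ρ ^ 2 := by
        simp only [hg]; exact slabGauge_le ν 1 ρ p hp1 hp2 hp3
      have hlt : 1 ^ 2 * ρ ^ 2 < g q := by
        simp only [hg]
        exact lt_slabGauge ν 1 ρ one_pos (by linarith) q (hout p hp hd)
      linarith
  have hmain := zoned_cross_le X P hX hPX Z n hn E hE g hconv hz0' hz1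
  calc ((((P ×ˢ (X \ P)).filter fun pq => dist pq.1 pq.2 = 1).card : ℕ) : ℝ)
      ≤ contactDeficiency (X \ P) + 6 * (E.card : ℝ) := hmain
    _ ≤ contactDeficiency (X \ P) + 6 * ρ := by linarith

end Summit.Ventures.Crystal3D.Theorems

end
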